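import Mathlib
import Summits.Ventures.PercRepro2.KPrimePendantLemmas
import Summits.Ventures.PercRepro2.KPrimePendantB
import Summits.Ventures.PercRepro2.KPrimeLeafMartingale

/-!
# The marks `b` and `y` on a leaf: `(K′)` and `(K′-T)` scale by the leaf weight
(blind cell PercRepro2, mine-c g41; `conjectures/MINE-C.md` §50.5)

Let the mark `b` be a LEAF whose only edge is `e = {b, z}` (`z` any other vertex, weight
`t = p e`).  Then `{x ↔ b} = {e open} ∩ {x ↔ z}` for every `x ≠ b` (`connEvent_leaf_eq`), every
other event of the forms is flip-invariant at `e`, and each mass carrying `b` is `t` times the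
corresponding mass of the `z`-INSTANCE (the same graph with `z` in the role of `b`):
`kprimeForm_pendant_b` — the cleared `(K′)` form at the lean `(P(X∩N), P(N))` is `t` times the
form of the `z`-instance — and `mtForm_pendant_b` likewise for the margin form `(K′-T)`.  The
same holds for the mark `y` on a leaf (`kprimeForm_pendant_y`, `mtForm_pendant_y`; there the
lean is untouched).  Hence **`(K′)` and `(K′-T)` are inherited from the `z`-instance when `b` or
`y` is hung on a leaf** (`kprimeHolds_of_pendant_b`, `kprimeHolds_of_pendant_y`,
`kprimeTHolds_of_pendant_b`, `kprimeTHolds_of_pendant_y`), for every weight of the leaf edge —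
the companions of g37's equality locus `kprimeHolds_of_pendant_b` (`b` at `a₁`, where the
`z`-instance has `z = a₁` and the form vanishes) and of g34's pendant step for `v`
(`kprime_of_pendant_T`, which needs `(K′-T)`).  With `KPrimeLeafExt.lean` the cycles and
necklaces are closed under hanging any of `b, v, y` on leaves.
-/

namespace Summit.Ventures.PercRepro2

namespace KPrime

variable {V : Type*} {E : Type*} [Fintype E] [DecidableEq E] [Fintype V] [DecidableEq V]
  {R : Type*} [Field R] [LinearOrder R] [IsStrictOrderedRing R]

section Leaf

variable {ends : E → Sym2 V} {m z : V} {e : E}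

omit [Fintype E] [DecidableEq E] [Fintype V] [DecidableEq V] [Field R] [LinearOrder R]
  [IsStrictOrderedRing R] in
/-- For a leaf `m` with the single edge `e = {m, z}` and a vertex `x ≠ m`:
`{x ↔ m} = {e open} ∩ {x ↔ z}`. -/
lemma connEvent_leaf_eq (hleaf : ∀ f, m ∈ ends f → f = e) (hends : ends e = s(m, z)) {x : V}
    (hx : x ≠ m) : connEvent ends x m = openEdge e ∩ connEvent ends x z := by
  ext ω
  simp only [mem_connEvent, Set.mem_inter_iff, mem_openEdge]
  constructor
  · intro h
    have hopen : ω e = true := by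
      by_contra hne
      have hfalse : ω e = false := by simpa using hne
      exact hx (conn_eq_of_isolated hleaf hfalse (conn_symm h))
    exact ⟨hopen, conn_trans h (conn_of_openAdj ⟨e, hopen, hends⟩)⟩
  · rintro ⟨hopen, h⟩
    exact conn_trans h (conn_symm (conn_of_openAdj ⟨e, hopen, hends⟩))

end Leaf

/-! ## The mark `b` on a leaf -/

section PendantB

variable {ends : E → Sym2 V} {a₁ a₂ b v y z : V} {p : E → R} {e : E}

omit [Fintype V] [IsStrictOrderedRing R] in
/-- **The mark `b` on a leaf at `z`**: the cleared `(K′)` form at the lean `(P(X∩N), P(N))` is the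
leaf weight times the form of the `z`-instance. -/
theorem kprimeForm_pendant_b (hleaf : ∀ f, b ∈ ends f → f = e) (hends : ends e = s(b, z))
    (hb₁ : a₁ ≠ b) (hb₂ : a₂ ≠ b) (hbv : v ≠ b) (hby : y ≠ b) (hbz : z ≠ b) :
    kprimeForm ends a₁ a₂ b v y p (prob p (connEvent ends a₁ b ∩ N ends a₁ a₂ v))
        (prob p (N ends a₁ a₂ v)) =
      p e * kprimeForm ends a₁ a₂ z v y p (prob p (connEvent ends a₁ z ∩ N ends a₁ a₂ v))
        (prob p (N ends a₁ a₂ v)) := by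
  have hX : connEvent ends a₁ b = openEdge e ∩ connEvent ends a₁ z :=
    connEvent_leaf_eq hleaf hends hb₁
  have hCv : connEvent ends v b = openEdge e ∩ connEvent ends v z :=
    connEvent_leaf_eq hleaf hends hbv
  have fU : FlipInvAt p e (connEvent ends a₁ v) := flipInvAt_connEvent hleaf hends hb₁ hbv
  have fZ : FlipInvAt p e (connEvent ends a₁ z) := flipInvAt_connEvent hleaf hends hb₁ hbz
  have fVZ : FlipInvAt p e (connEvent ends v z) := flipInvAt_connEvent hleaf hends hbv hbz
  have fY : FlipInvAt p e (connEvent ends a₂ y) := flipInvAt_connEvent hleaf hends hb₂ hby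
  have fW : FlipInvAt p e (connEvent ends a₁ y) := flipInvAt_connEvent hleaf hends hb₁ hby
  have fΩ : FlipInvAt p e (Ω ends a₁ a₂) :=
    flipInvAt_avoidAll hleaf hends hb₁ (by simpa using hb₂)
  have fS : FlipInvAt p e (S ends a₁ a₂ v) := by
    refine flipInvAt_avoidAll hleaf hends hb₂ ?_
    intro x hx
    simp only [Finset.mem_insert, Finset.mem_singleton] at hx
    rcases hx with rfl | rfl
    · exact hb₁
    · exact hbv
  have fN : FlipInvAt p e (N ends a₁ a₂ v) := by
    refine flipInvAt_avoidAll hleaf hends hb₁ ?_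
    intro x hx
    simp only [Finset.mem_insert, Finset.mem_singleton] at hx
    rcases hx with rfl | rfl
    · exact hb₂
    · exact hbv
  have hA : prob p (connEvent ends a₁ v ∩ connEvent ends a₁ b ∩ Ω ends a₁ a₂) =
      p e * prob p (connEvent ends a₁ v ∩ connEvent ends a₁ z ∩ Ω ends a₁ a₂) := by
    have hset : connEvent ends a₁ v ∩ connEvent ends a₁ b ∩ Ω ends a₁ a₂ =
        (connEvent ends a₁ v ∩ connEvent ends a₁ z ∩ Ω ends a₁ a₂) ∩ openEdge e := by
      rw [hX]; ext ω; simp only [Set.mem_inter_iff]; tauto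
    rw [hset]
    exact prob_inter_openEdge_of_flipInvAt ((fU.inter fZ).inter fΩ)
  have hN₀ : prob p (connEvent ends a₁ b ∩ N ends a₁ a₂ v) =
      p e * prob p (connEvent ends a₁ z ∩ N ends a₁ a₂ v) := by
    have hset : connEvent ends a₁ b ∩ N ends a₁ a₂ v =
        (connEvent ends a₁ z ∩ N ends a₁ a₂ v) ∩ openEdge e := by
      rw [hX]; ext ω; simp only [Set.mem_inter_iff]; tauto
    rw [hset]
    exact prob_inter_openEdge_of_flipInvAt (fZ.inter fN)
  have hC : prob p (connEvent ends a₁ v ∩ connEvent ends a₂ y ∩ connEvent ends a₁ b ∩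
      Ω ends a₁ a₂) =
      p e * prob p (connEvent ends a₁ v ∩ connEvent ends a₂ y ∩ connEvent ends a₁ z ∩
        Ω ends a₁ a₂) := by
    have hset : connEvent ends a₁ v ∩ connEvent ends a₂ y ∩ connEvent ends a₁ b ∩ Ω ends a₁ a₂ =
        (connEvent ends a₁ v ∩ connEvent ends a₂ y ∩ connEvent ends a₁ z ∩ Ω ends a₁ a₂) ∩
          openEdge e := by
      rw [hX]; ext ω; simp only [Set.mem_inter_iff]; tauto
    rw [hset]
    exact prob_inter_openEdge_of_flipInvAt (((fU.inter fY).inter fZ).inter fΩ)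
  have hO1e : prob p (cls01e ends a₁ a₂ b v y) = p e * prob p (cls01e ends a₁ a₂ z v y) := by
    have hset : cls01e ends a₁ a₂ b v y = cls01e ends a₁ a₂ z v y ∩ openEdge e := by
      unfold cls01e
      rw [hX, hCv]; ext ω; simp only [Set.mem_inter_iff, Set.mem_union]; tauto
    rw [hset]
    exact prob_inter_openEdge_of_flipInvAt
      ((((fU.compl.inter fW).inter fS).inter (fZ.union fVZ)))
  unfold kprimeForm
  rw [hA, hN₀, hC, hO1e]
  ring

omit [Fintype V] [IsStrictOrderedRing R] in
/-- **The mark `b` on a leaf at `z`**: the margin form `mtForm` is the leaf weight times the margin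
form of the `z`-instance. -/
theorem mtForm_pendant_b (hleaf : ∀ f, b ∈ ends f → f = e) (hends : ends e = s(b, z))
    (hb₁ : a₁ ≠ b) (hb₂ : a₂ ≠ b) (hbv : v ≠ b) (hby : y ≠ b) (hbz : z ≠ b) :
    mtForm ends a₁ a₂ b v y p = p e * mtForm ends a₁ a₂ z v y p := by
  have hX : connEvent ends a₁ b = openEdge e ∩ connEvent ends a₁ z :=
    connEvent_leaf_eq hleaf hends hb₁
  have hCv : connEvent ends v b = openEdge e ∩ connEvent ends v z :=
    connEvent_leaf_eq hleaf hends hbv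
  have fU : FlipInvAt p e (connEvent ends a₁ v) := flipInvAt_connEvent hleaf hends hb₁ hbv
  have fZ : FlipInvAt p e (connEvent ends a₁ z) := flipInvAt_connEvent hleaf hends hb₁ hbz
  have fVZ : FlipInvAt p e (connEvent ends v z) := flipInvAt_connEvent hleaf hends hbv hbz
  have fY : FlipInvAt p e (connEvent ends a₂ y) := flipInvAt_connEvent hleaf hends hb₂ hby
  have fW : FlipInvAt p e (connEvent ends a₁ y) := flipInvAt_connEvent hleaf hends hb₁ hby
  have fΩ : FlipInvAt p e (Ω ends a₁ a₂) :=
    flipInvAt_avoidAll hleaf hends hb₁ (by simpa using hb₂)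
  have fS : FlipInvAt p e (S ends a₁ a₂ v) := by
    refine flipInvAt_avoidAll hleaf hends hb₂ ?_
    intro x hx
    simp only [Finset.mem_insert, Finset.mem_singleton] at hx
    rcases hx with rfl | rfl
    · exact hb₁
    · exact hbv
  have hA : prob p (connEvent ends a₁ v ∩ connEvent ends a₁ b ∩ Ω ends a₁ a₂) =
      p e * prob p (connEvent ends a₁ v ∩ connEvent ends a₁ z ∩ Ω ends a₁ a₂) := by
    have hset : connEvent ends a₁ v ∩ connEvent ends a₁ b ∩ Ω ends a₁ a₂ =
        (connEvent ends a₁ v ∩ connEvent ends a₁ z ∩ Ω ends a₁ a₂) ∩ openEdge e := by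
      rw [hX]; ext ω; simp only [Set.mem_inter_iff]; tauto
    rw [hset]
    exact prob_inter_openEdge_of_flipInvAt ((fU.inter fZ).inter fΩ)
  have hXΩ : prob p (connEvent ends a₁ b ∩ Ω ends a₁ a₂) =
      p e * prob p (connEvent ends a₁ z ∩ Ω ends a₁ a₂) := by
    have hset : connEvent ends a₁ b ∩ Ω ends a₁ a₂ =
        (connEvent ends a₁ z ∩ Ω ends a₁ a₂) ∩ openEdge e := by
      rw [hX]; ext ω; simp only [Set.mem_inter_iff]; tauto
    rw [hset]
    exact prob_inter_openEdge_of_flipInvAt (fZ.inter fΩ)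
  have hC : prob p (connEvent ends a₁ v ∩ connEvent ends a₂ y ∩ connEvent ends a₁ b ∩
      Ω ends a₁ a₂) =
      p e * prob p (connEvent ends a₁ v ∩ connEvent ends a₂ y ∩ connEvent ends a₁ z ∩
        Ω ends a₁ a₂) := by
    have hset : connEvent ends a₁ v ∩ connEvent ends a₂ y ∩ connEvent ends a₁ b ∩ Ω ends a₁ a₂ =
        (connEvent ends a₁ v ∩ connEvent ends a₂ y ∩ connEvent ends a₁ z ∩ Ω ends a₁ a₂) ∩
          openEdge e := by
      rw [hX]; ext ω; simp only [Set.mem_inter_iff]; tauto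
    rw [hset]
    exact prob_inter_openEdge_of_flipInvAt (((fU.inter fY).inter fZ).inter fΩ)
  have hO1e : prob p (cls01e ends a₁ a₂ b v y) = p e * prob p (cls01e ends a₁ a₂ z v y) := by
    have hset : cls01e ends a₁ a₂ b v y = cls01e ends a₁ a₂ z v y ∩ openEdge e := by
      unfold cls01e
      rw [hX, hCv]; ext ω; simp only [Set.mem_inter_iff, Set.mem_union]; tauto
    rw [hset]
    exact prob_inter_openEdge_of_flipInvAt
      ((((fU.compl.inter fW).inter fS).inter (fZ.union fVZ)))
  unfold mtForm
  rw [hA, hXΩ, hC, hO1e]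
  ring

omit [Fintype V] in
/-- `(K′)` is inherited from the `z`-instance when `b` is a leaf at `z`. -/
theorem kprimeHolds_of_pendant_b_at (hp : IsProbVec p) (hleaf : ∀ f, b ∈ ends f → f = e)
    (hends : ends e = s(b, z)) (hb₁ : a₁ ≠ b) (hb₂ : a₂ ≠ b) (hbv : v ≠ b) (hby : y ≠ b)
    (hbz : z ≠ b) (H : KPrimeHolds ends a₁ a₂ z v y p) : KPrimeHolds ends a₁ a₂ b v y p := by
  unfold KPrimeHolds at H ⊢
  rw [kprimeForm_pendant_b hleaf hends hb₁ hb₂ hbv hby hbz]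
  exact mul_nonneg (hp.nonneg e) H

omit [Fintype V] in
/-- `(K′-T)` is inherited from the `z`-instance when `b` is a leaf at `z`. -/
theorem kprimeTHolds_of_pendant_b_at (hp : IsProbVec p) (hleaf : ∀ f, b ∈ ends f → f = e)
    (hends : ends e = s(b, z)) (hb₁ : a₁ ≠ b) (hb₂ : a₂ ≠ b) (hbv : v ≠ b) (hby : y ≠ b)
    (hbz : z ≠ b) (H : KPrimeTHolds ends a₁ a₂ z v y p) : KPrimeTHolds ends a₁ a₂ b v y p := by
  unfold KPrimeTHolds at H ⊢
  rw [mtForm_pendant_b hleaf hends hb₁ hb₂ hbv hby hbz]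
  exact mul_nonneg (hp.nonneg e) H

end PendantB

/-! ## The mark `y` on a leaf -/

section PendantY

variable {ends : E → Sym2 V} {a₁ a₂ b v y z : V} {p : E → R} {e : E}

omit [Fintype V] [IsStrictOrderedRing R] in
/-- **The mark `y` on a leaf at `z`**: the cleared `(K′)` form is the leaf weight times the form of
the `z`-instance (the lean `(N₀, D₀)` does not see `y`). -/
theorem kprimeForm_pendant_y (hleaf : ∀ f, y ∈ ends f → f = e) (hends : ends e = s(y, z))
    (hy₁ : a₁ ≠ y) (hy₂ : a₂ ≠ y) (hyb : b ≠ y) (hyv : v ≠ y) (hyz : z ≠ y) (N₀ D₀ : R) :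
    kprimeForm ends a₁ a₂ b v y p N₀ D₀ = p e * kprimeForm ends a₁ a₂ b v z p N₀ D₀ := by
  have hY : connEvent ends a₂ y = openEdge e ∩ connEvent ends a₂ z :=
    connEvent_leaf_eq hleaf hends hy₂
  have hW : connEvent ends a₁ y = openEdge e ∩ connEvent ends a₁ z :=
    connEvent_leaf_eq hleaf hends hy₁
  have fU : FlipInvAt p e (connEvent ends a₁ v) := flipInvAt_connEvent hleaf hends hy₁ hyv
  have fX : FlipInvAt p e (connEvent ends a₁ b) := flipInvAt_connEvent hleaf hends hy₁ hyb
  have fZ₂ : FlipInvAt p e (connEvent ends a₂ z) := flipInvAt_connEvent hleaf hends hy₂ hyz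
  have fZ₁ : FlipInvAt p e (connEvent ends a₁ z) := flipInvAt_connEvent hleaf hends hy₁ hyz
  have fCv : FlipInvAt p e (connEvent ends v b) := flipInvAt_connEvent hleaf hends hyv hyb
  have fΩ : FlipInvAt p e (Ω ends a₁ a₂) :=
    flipInvAt_avoidAll hleaf hends hy₁ (by simpa using hy₂)
  have fS : FlipInvAt p e (S ends a₁ a₂ v) := by
    refine flipInvAt_avoidAll hleaf hends hy₂ ?_
    intro x hx
    simp only [Finset.mem_insert, Finset.mem_singleton] at hx
    rcases hx with rfl | rfl
    · exact hy₁
    · exact hyv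
  have hYS : prob p (connEvent ends a₂ y ∩ S ends a₁ a₂ v) =
      p e * prob p (connEvent ends a₂ z ∩ S ends a₁ a₂ v) := by
    have hset : connEvent ends a₂ y ∩ S ends a₁ a₂ v =
        (connEvent ends a₂ z ∩ S ends a₁ a₂ v) ∩ openEdge e := by
      rw [hY]; ext ω; simp only [Set.mem_inter_iff]; tauto
    rw [hset]
    exact prob_inter_openEdge_of_flipInvAt (fZ₂.inter fS)
  have hC : prob p (connEvent ends a₁ v ∩ connEvent ends a₂ y ∩ connEvent ends a₁ b ∩
      Ω ends a₁ a₂) =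
      p e * prob p (connEvent ends a₁ v ∩ connEvent ends a₂ z ∩ connEvent ends a₁ b ∩
        Ω ends a₁ a₂) := by
    have hset : connEvent ends a₁ v ∩ connEvent ends a₂ y ∩ connEvent ends a₁ b ∩ Ω ends a₁ a₂ =
        (connEvent ends a₁ v ∩ connEvent ends a₂ z ∩ connEvent ends a₁ b ∩ Ω ends a₁ a₂) ∩
          openEdge e := by
      rw [hY]; ext ω; simp only [Set.mem_inter_iff]; tauto
    rw [hset]
    exact prob_inter_openEdge_of_flipInvAt (((fU.inter fZ₂).inter fX).inter fΩ)
  have hD : prob p (connEvent ends a₁ v ∩ connEvent ends a₂ y ∩ Ω ends a₁ a₂) =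
      p e * prob p (connEvent ends a₁ v ∩ connEvent ends a₂ z ∩ Ω ends a₁ a₂) := by
    have hset : connEvent ends a₁ v ∩ connEvent ends a₂ y ∩ Ω ends a₁ a₂ =
        (connEvent ends a₁ v ∩ connEvent ends a₂ z ∩ Ω ends a₁ a₂) ∩ openEdge e := by
      rw [hY]; ext ω; simp only [Set.mem_inter_iff]; tauto
    rw [hset]
    exact prob_inter_openEdge_of_flipInvAt ((fU.inter fZ₂).inter fΩ)
  have hO1 : prob p (cls01 ends a₁ a₂ v y) = p e * prob p (cls01 ends a₁ a₂ v z) := by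
    have hset : cls01 ends a₁ a₂ v y = cls01 ends a₁ a₂ v z ∩ openEdge e := by
      unfold cls01
      rw [hW]; ext ω; simp only [Set.mem_inter_iff, Set.mem_compl_iff]; tauto
    rw [hset]
    exact prob_inter_openEdge_of_flipInvAt ((fU.compl.inter fZ₁).inter fS)
  have hO1e : prob p (cls01e ends a₁ a₂ b v y) = p e * prob p (cls01e ends a₁ a₂ b v z) := by
    have hset : cls01e ends a₁ a₂ b v y = cls01e ends a₁ a₂ b v z ∩ openEdge e := by
      unfold cls01e
      rw [hW]; ext ω
      simp only [Set.mem_inter_iff, Set.mem_union, Set.mem_compl_iff]; tauto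
    rw [hset]
    exact prob_inter_openEdge_of_flipInvAt
      ((((fU.compl.inter fZ₁).inter fS).inter (fX.union fCv)))
  unfold kprimeForm
  rw [hYS, hC, hD, hO1, hO1e]
  ring

omit [Fintype V] [IsStrictOrderedRing R] in
/-- **The mark `y` on a leaf at `z`**: the margin form is the leaf weight times the margin form of
the `z`-instance. -/
theorem mtForm_pendant_y (hleaf : ∀ f, y ∈ ends f → f = e) (hends : ends e = s(y, z))
    (hy₁ : a₁ ≠ y) (hy₂ : a₂ ≠ y) (hyb : b ≠ y) (hyv : v ≠ y) (hyz : z ≠ y) :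
    mtForm ends a₁ a₂ b v y p = p e * mtForm ends a₁ a₂ b v z p := by
  have hY : connEvent ends a₂ y = openEdge e ∩ connEvent ends a₂ z :=
    connEvent_leaf_eq hleaf hends hy₂
  have hW : connEvent ends a₁ y = openEdge e ∩ connEvent ends a₁ z :=
    connEvent_leaf_eq hleaf hends hy₁
  have fU : FlipInvAt p e (connEvent ends a₁ v) := flipInvAt_connEvent hleaf hends hy₁ hyv
  have fX : FlipInvAt p e (connEvent ends a₁ b) := flipInvAt_connEvent hleaf hends hy₁ hyb
  have fZ₂ : FlipInvAt p e (connEvent ends a₂ z) := flipInvAt_connEvent hleaf hends hy₂ hyz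
  have fZ₁ : FlipInvAt p e (connEvent ends a₁ z) := flipInvAt_connEvent hleaf hends hy₁ hyz
  have fCv : FlipInvAt p e (connEvent ends v b) := flipInvAt_connEvent hleaf hends hyv hyb
  have fΩ : FlipInvAt p e (Ω ends a₁ a₂) :=
    flipInvAt_avoidAll hleaf hends hy₁ (by simpa using hy₂)
  have fS : FlipInvAt p e (S ends a₁ a₂ v) := by
    refine flipInvAt_avoidAll hleaf hends hy₂ ?_
    intro x hx
    simp only [Finset.mem_insert, Finset.mem_singleton] at hx
    rcases hx with rfl | rfl
    · exact hy₁
    · exact hyv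
  have hC : prob p (connEvent ends a₁ v ∩ connEvent ends a₂ y ∩ connEvent ends a₁ b ∩
      Ω ends a₁ a₂) =
      p e * prob p (connEvent ends a₁ v ∩ connEvent ends a₂ z ∩ connEvent ends a₁ b ∩
        Ω ends a₁ a₂) := by
    have hset : connEvent ends a₁ v ∩ connEvent ends a₂ y ∩ connEvent ends a₁ b ∩ Ω ends a₁ a₂ =
        (connEvent ends a₁ v ∩ connEvent ends a₂ z ∩ connEvent ends a₁ b ∩ Ω ends a₁ a₂) ∩
          openEdge e := by
      rw [hY]; ext ω; simp only [Set.mem_inter_iff]; tauto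
    rw [hset]
    exact prob_inter_openEdge_of_flipInvAt (((fU.inter fZ₂).inter fX).inter fΩ)
  have hD : prob p (connEvent ends a₁ v ∩ connEvent ends a₂ y ∩ Ω ends a₁ a₂) =
      p e * prob p (connEvent ends a₁ v ∩ connEvent ends a₂ z ∩ Ω ends a₁ a₂) := by
    have hset : connEvent ends a₁ v ∩ connEvent ends a₂ y ∩ Ω ends a₁ a₂ =
        (connEvent ends a₁ v ∩ connEvent ends a₂ z ∩ Ω ends a₁ a₂) ∩ openEdge e := by
      rw [hY]; ext ω; simp only [Set.mem_inter_iff]; tauto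
    rw [hset]
    exact prob_inter_openEdge_of_flipInvAt ((fU.inter fZ₂).inter fΩ)
  have hO1 : prob p (cls01 ends a₁ a₂ v y) = p e * prob p (cls01 ends a₁ a₂ v z) := by
    have hset : cls01 ends a₁ a₂ v y = cls01 ends a₁ a₂ v z ∩ openEdge e := by
      unfold cls01
      rw [hW]; ext ω; simp only [Set.mem_inter_iff, Set.mem_compl_iff]; tauto
    rw [hset]
    exact prob_inter_openEdge_of_flipInvAt ((fU.compl.inter fZ₁).inter fS)
  have hO1e : prob p (cls01e ends a₁ a₂ b v y) = p e * prob p (cls01e ends a₁ a₂ b v z) := by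
    have hset : cls01e ends a₁ a₂ b v y = cls01e ends a₁ a₂ b v z ∩ openEdge e := by
      unfold cls01e
      rw [hW]; ext ω
      simp only [Set.mem_inter_iff, Set.mem_union, Set.mem_compl_iff]; tauto
    rw [hset]
    exact prob_inter_openEdge_of_flipInvAt
      ((((fU.compl.inter fZ₁).inter fS).inter (fX.union fCv)))
  have hWΩ : prob p (connEvent ends a₁ y ∩ Ω ends a₁ a₂) =
      p e * prob p (connEvent ends a₁ z ∩ Ω ends a₁ a₂) := by
    have hset : connEvent ends a₁ y ∩ Ω ends a₁ a₂ =
        (connEvent ends a₁ z ∩ Ω ends a₁ a₂) ∩ openEdge e := by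
      rw [hW]; ext ω; simp only [Set.mem_inter_iff]; tauto
    rw [hset]
    exact prob_inter_openEdge_of_flipInvAt (fZ₁.inter fΩ)
  have hYΩ : prob p (connEvent ends a₂ y ∩ Ω ends a₁ a₂) =
      p e * prob p (connEvent ends a₂ z ∩ Ω ends a₁ a₂) := by
    have hset : connEvent ends a₂ y ∩ Ω ends a₁ a₂ =
        (connEvent ends a₂ z ∩ Ω ends a₁ a₂) ∩ openEdge e := by
      rw [hY]; ext ω; simp only [Set.mem_inter_iff]; tauto
    rw [hset]
    exact prob_inter_openEdge_of_flipInvAt (fZ₂.inter fΩ)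
  unfold mtForm
  rw [hC, hD, hO1, hO1e, hWΩ, hYΩ]
  ring

omit [Fintype V] in
/-- `(K′)` is inherited from the `z`-instance when `y` is a leaf at `z`. -/
theorem kprimeHolds_of_pendant_y (hp : IsProbVec p) (hleaf : ∀ f, y ∈ ends f → f = e)
    (hends : ends e = s(y, z)) (hy₁ : a₁ ≠ y) (hy₂ : a₂ ≠ y) (hyb : b ≠ y) (hyv : v ≠ y)
    (hyz : z ≠ y) (H : KPrimeHolds ends a₁ a₂ b v z p) : KPrimeHolds ends a₁ a₂ b v y p := by
  unfold KPrimeHolds at H ⊢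
  rw [kprimeForm_pendant_y hleaf hends hy₁ hy₂ hyb hyv hyz]
  exact mul_nonneg (hp.nonneg e) H

omit [Fintype V] in
/-- `(K′-T)` is inherited from the `z`-instance when `y` is a leaf at `z`. -/
theorem kprimeTHolds_of_pendant_y (hp : IsProbVec p) (hleaf : ∀ f, y ∈ ends f → f = e)
    (hends : ends e = s(y, z)) (hy₁ : a₁ ≠ y) (hy₂ : a₂ ≠ y) (hyb : b ≠ y) (hyv : v ≠ y)
    (hyz : z ≠ y) (H : KPrimeTHolds ends a₁ a₂ b v z p) : KPrimeTHolds ends a₁ a₂ b v y p := by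
  unfold KPrimeTHolds at H ⊢
  rw [mtForm_pendant_y hleaf hends hy₁ hy₂ hyb hyv hyz]
  exact mul_nonneg (hp.nonneg e) H

end PendantY

end KPrime

end Summit.Ventures.PercRepro2
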